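import Mathlib
import Summits.PneNP.PneNP.Theses.OneSlice
import Summits.PneNP.PneNP.Theorems.OneSliceSliceTargetSplit
import Literature.Computability.Complexity.NegationLimitedProofs

/-!
# Route OneSlice, crux `MonotoneContinuation` (stmt-PneNP-18471), line `Sketch_ideator1_r1` (ProfileLine) — stub samplerCircuit

A majority vote of `t ≥ 1` restricted copies of a monotone circuit `C` over the edges of `Kₙ`
(`n ≥ 2`) — deletion copies `y ↦ C(y ∧ ρₐ)` or padding copies `y ↦ C(y ∨ ρₐ)` for `t` FIXED
restrictions `ρₐ` — is computed, on every input other than the all-false and the all-true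
vector, by a monotone circuit over `{∧₂, ∨₂}` of size `≤ t (|C| + 2N + 2) + 4t² + 4`
(`N = C(n,2)`). The construction stays inside the constant-free monotone basis throughout
(gate-list calculus `CktSize` of `CircuitComposition.lean`): the missing constant `false`
(resp. `true`) feeding the deleted (resp. padded) inputs of the copies is replaced by the
conjunction (resp. disjunction) of all `N` inputs (`cktSize_all` / `cktSize_any`, `N` gates,
correct off the all-true resp. all-false vector), the `t` copies of `C` are re-wired copies of its
own gate list (`Circuit.cktSize_eval`, `CktSize.rewire`, `CktSize.pi_const`, `t |C|` gates), and
the majority of the `t` votes is the top prefix threshold `Th_{⌊t/2⌋+1}` of the monotone dynamic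
programme `cktSize_tabT` of `NegationLimitedProofs.lean` (`2 t (t-1)` gates), read through the
identification of the prefix count `pcount` with the number of accepting copies.
-/

set_option linter.dupNamespace false -- `Summit.PneNP.PneNP.…`: summit = sub-problem (D-0017)

namespace Summit.PneNP.PneNP.Theorems.MonotoneContinuation

open Literature.Computability.Complexity hiding supp mem_supp
open Finset hiding slice
open Filter hiding mem_sdiff
open Classical
open Summit.PneNP.PneNP.Theorems (binomialWeight_tail_le binomialWeight_sum_range binomialWeight_nonneg
  binomialWeight_variance card_slice)
open Summit.PneNP.PneNP.Theorems.ConstantBand.Negative (Edge thr Central slice)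
open Summit.PneNP.PneNP.Theorems.SingleThreshold.Negative (pc)
open Summit.PneNP.PneNP.Theorems.SliceACZero.Negative (supp mem_supp card_supp supp_injective supp_indicator)
open Summit.PneNP.PneNP.Theorems.SliceTargetSplit (Comp nbhd mem_nbhd transport ind l1 nbhdCard card_nbhd
  card_nbhd_of_le card_nbhd_of_ge choose_mul_nbhdCard nbhdCard_pos sum_slice_sum_nbhd sum_slice_sum_nbhd_left
  supp_subset_of_comp_of_le comp_iff_supp comp_comm ofSet supp_ofSet ofSet_supp edgeCount_ofSet ind_nonneg
  ind_le_one abs_ind_sub_ind l1_triangle l1_comm l1_nonneg transport_nonneg transport_sub)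

noncomputable section

variable {n : ℕ}

/-! ### The prefix count is the number of ones -/

/-- The prefix count `pcount z l` of `NegationLimitedProofs.lean` is the sum of the first `l` bits.
[folklore] -/
private theorem samplerCircuit_pcount_eq_sum {t : ℕ} (z : Fin t → Bool) :
    ∀ l, pcount z l = ∑ i ∈ range l, (if h : i < t then (z ⟨i, h⟩).toNat else 0)
  | 0 => by simp
  | l + 1 => by
    show pcount z l + (if h : l < t then (z ⟨l, h⟩).toNat else 0) = _
    rw [samplerCircuit_pcount_eq_sum z l, Finset.sum_range_succ]

/-- The full prefix count `pcount z t` is the number of ones of `z : Fin t → Bool`. [folklore] -/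
private theorem samplerCircuit_pcount_eq_card {t : ℕ} (z : Fin t → Bool) :
    pcount z t = #(univ.filter fun a : Fin t => z a = true) := by
  rw [samplerCircuit_pcount_eq_sum, Finset.card_filter, Finset.sum_fin_eq_sum_range]
  refine Finset.sum_congr rfl fun i _ => ?_
  by_cases h : i < t
  · rw [dif_pos h, dif_pos h]
    cases z ⟨i, h⟩ <;> simp
  · rw [dif_neg h, dif_neg h]

/-! ### A monotone majority circuit -/

/-- **Monotone majority.** The strict majority `[t < 2 · #{a | zₐ = 1}]` of `t ≥ 1` bits is computed
over `{∧₂, ∨₂}` with `2 t (t - 1)` gates: it is the top prefix threshold `Th_{⌊t/2⌋+1}(z₀, …, z_{t-1})`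
of the dynamic programme `cktSize_tabT`. [folklore] -/
private theorem samplerCircuit_majVote (t : ℕ) (ht : 0 < t) :
    CktSize monotoneBasis (fun (z : Fin t → Bool) (_ : Unit) =>
      decide (t < 2 * #(univ.filter fun a : Fin t => z a = true))) (t * 2 * (t - 1)) := by
  have ht1 : t - 1 < t := by omega
  have ht2 : t / 2 < t := by omega
  have ht' : 1 ≤ t := ht
  refine ((cktSize_tabT (n := t) (t - 1) ht1).outMap fun _ : Unit =>
    (Sum.inr (⟨t - 1, ht1⟩, ⟨t / 2, ht2⟩) : Fin t ⊕ (Fin t × Fin t))).congr fun z _ => ?_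
  simp only [tabT, Sum.elim_inr, pthr, min_self, Nat.sub_add_cancel ht',
    samplerCircuit_pcount_eq_card]
  rw [decide_eq_decide]
  omega

/-! ### Re-wired copies of a circuit behind a preprocessing stage -/

/-- **Copies.** Given a monotone circuit `C` on inputs `ι`, one extra monotone wire `g` of cost `sg`,
and for each `a < t` a re-wiring `σ a` of the inputs of `C` to the inputs or to the extra wire, the
`t` re-wired copies of `C` are computed simultaneously over `{∧₂, ∨₂}` with `sg + t |C|` gates
(projection closure and parallel composition of straight-line programs). [folklore] -/
private theorem samplerCircuit_copies {ι : Type*} {t : ℕ} (C : Circuit ι) (hC : C.IsOver monotoneBasis)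
    {g : (ι → Bool) → Unit → Bool} {sg : ℕ} (hg : CktSize monotoneBasis g sg)
    (σ : Fin t → ι → ι ⊕ Unit) :
    CktSize monotoneBasis (fun (y : ι → Bool) (a : Fin t) =>
      C.eval (fun e => Sum.elim y (g y) (σ a e))) (sg + t * C.size) := by
  have hA : CktSize monotoneBasis (fun (y : ι → Bool) => Sum.elim y (g y)) (0 + sg) :=
    (CktSize.id monotoneBasis).pair hg
  have hB : CktSize monotoneBasis (fun (w : ι ⊕ Unit → Bool) (a : Fin t) =>
      C.eval (fun e => w (σ a e))) (Fintype.card (Fin t) * C.size) :=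
    CktSize.pi_const fun a => (C.cktSize_eval hC).rewire (σ a)
  have h := (hA.comp hB).of_le (s' := sg + t * C.size) (by simp)
  exact h.congr fun y a => rfl

/-! ### Book-keeping -/

/-- Changing the votes pointwise does not change the majority. [folklore] -/
private theorem samplerCircuit_congr {t : ℕ} {P Q : Fin t → Bool} (h : ∀ a, P a = Q a) :
    decide (t < 2 * #(univ.filter fun a : Fin t => P a = true)) =
      decide (t < 2 * #(univ.filter fun a : Fin t => Q a = true)) := by
  have hPQ : P = Q := funext h
  subst hPQ
  rfl

/-- The size budget: `N + t c + 2 t (t - 1) ≤ t (c + 2N + 2) + 4 t² + 4` for `t ≥ 1`. [folklore] -/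
private theorem samplerCircuit_arith {N c t m l : ℕ} (ht : 0 < t) (hl : l = N)
    (hm : m ≤ l + t * c + t * 2 * (t - 1)) : m ≤ t * (c + 2 * N + 2) + 4 * t ^ 2 + 4 := by
  subst hl
  obtain ⟨s, rfl⟩ : ∃ s, t = s + 1 := ⟨t - 1, by omega⟩
  rw [Nat.add_sub_cancel] at hm
  nlinarith [Nat.zero_le (l * s), Nat.zero_le (s * s), Nat.zero_le (s * c), Nat.zero_le l,
    Nat.zero_le s, Nat.zero_le c]

/-! ### The stub -/

/-- **SamplerCircuit.** For `n ≥ 2`, `t ≥ 1`, a monotone circuit `C` over the edges of `Kₙ` and `t`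
fixed restrictions `ρₐ`, the majority votes of the deletion copies `y ↦ C(y ∧ ρₐ)` and of the padding
copies `y ↦ C(y ∨ ρₐ)` are each computed, on every input `y` that is neither all-false nor all-true,
by a monotone circuit over `{∧₂, ∨₂}` of size `≤ t (|C| + 2 C(n,2) + 2) + 4 t² + 4` (the constant
feeding the deleted / padded inputs is replaced by `⋀ inputs` / `⋁ inputs`; the majority is a
monotone threshold circuit). [folklore] -/
theorem stub_samplerCircuit :
  ∀ (n t : ℕ), 2 ≤ n → 0 < t → ∀ (C : Circuit (Edge n)), C.IsOver monotoneBasis → ∀ (ρs : Fin t → Edge n → Bool),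
    (∃ M : Circuit (Edge n), M.IsOver monotoneBasis ∧ M.size ≤ t * (C.size + 2 * n.choose 2 + 2) + 4 * t ^ 2 + 4 ∧
      ∀ y : Edge n → Bool, (∃ e, y e = false) → (∃ e, y e = true) →
        M.eval y = decide (t < 2 * #(univ.filter fun a : Fin t => C.eval (fun e => y e && ρs a e) = true))) ∧
    (∃ M : Circuit (Edge n), M.IsOver monotoneBasis ∧ M.size ≤ t * (C.size + 2 * n.choose 2 + 2) + 4 * t ^ 2 + 4 ∧
      ∀ y : Edge n → Bool, (∃ e, y e = false) → (∃ e, y e = true) →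
        M.eval y = decide (t < 2 * #(univ.filter fun a : Fin t => C.eval (fun e => y e || ρs a e) = true))) := by
  intro n t hn ht C hC ρs
  -- a list of all `N = C(n,2) ≥ 1` edges, feeding the fake constants `⋀ inputs` / `⋁ inputs`
  obtain ⟨L, hLlen, hmemL⟩ : ∃ L : List (Edge n), L.length = n.choose 2 ∧ ∀ e, e ∈ L :=
    ⟨(univ : Finset (Edge n)).toList, by rw [Finset.length_toList, card_univ, card_edgeSet_top_fin],
      fun e => Finset.mem_toList.2 (mem_univ e)⟩
  have hLne : L ≠ [] := by
    intro h0
    rw [h0, List.length_nil] at hLlen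
    have := Nat.choose_pos hn
    omega
  constructor
  · -- deletion copies: the deleted inputs read the fake `false := ⋀ inputs`
    obtain ⟨M, hMB, hMs, hMe⟩ := ((samplerCircuit_copies C hC (cktSize_all L hLne)
      (fun a e => if ρs a e = true then Sum.inl e else Sum.inr ())).comp
        (samplerCircuit_majVote t ht)).toCircuit
    refine ⟨M, hMB, samplerCircuit_arith ht hLlen hMs, fun y hy0 _ => ?_⟩
    obtain ⟨e₀, he₀⟩ := hy0
    have hall : (L.all fun i => y i) = false := List.all_eq_false.2 ⟨e₀, hmemL e₀, by simp [he₀]⟩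
    refine (hMe y).trans (samplerCircuit_congr fun a => ?_)
    congr 1
    funext e
    cases ρs a e <;> simp [hall]
  · -- padding copies: the padded inputs read the fake `true := ⋁ inputs`
    obtain ⟨M, hMB, hMs, hMe⟩ := ((samplerCircuit_copies C hC (cktSize_any L hLne)
      (fun a e => if ρs a e = true then Sum.inr () else Sum.inl e)).comp
        (samplerCircuit_majVote t ht)).toCircuit
    refine ⟨M, hMB, samplerCircuit_arith ht hLlen hMs, fun y _ hy1 => ?_⟩
    obtain ⟨e₁, he₁⟩ := hy1
    have hany : (L.any fun i => y i) = true := List.any_eq_true.2 ⟨e₁, hmemL e₁, he₁⟩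
    refine (hMe y).trans (samplerCircuit_congr fun a => ?_)
    congr 1
    funext e
    cases ρs a e <;> simp [hany]

end

end Summit.PneNP.PneNP.Theorems.MonotoneContinuation
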